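import Summits.BirchSwinnertonDyer.BirchSwinnertonDyer.Theorems.GenusKolyvaginAtTwoGenusPrimitiveSupplyAtTwoTwistUnramifiedMultRow
import Summits.BirchSwinnertonDyer.BirchSwinnertonDyer.Theorems.GenusKolyvaginAtTwoGenusPrimitiveSupplyAtTwoTwistTamagawaOdd
import HarnessLib

/-!
# Route `GenusKolyvaginAtTwo`, crux #2 `GenusPrimitiveSupplyAtTwo` (stmt-BirchSwinnertonDyer-22136):
# THE `T = ∅` LAW `#Sel₂(E^{(d)}) = #Sel₂(E)` FROM THE FIVE-ROW PLACE MENU — Lemma 2.10 (i), (ii), (iii), (iv), (v) of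
# Mazur–Rubin 2010 at EVERY place, the dyadic places included, over every number field, unconditionally

Width seat `bsd-line-gk2-p5` g11 (cell `bsd-f1-sign2`, SUPPLY lineage), file 41 of the series (sequel of `…TwistUnramifiedMultRow.lean`).
THEOREMS ONLY (no definition, no named fact, no `sorry`, no local instance); helper `--supports stmt-BirchSwinnertonDyer-22136`;
no item is closed; BSD is not proved by any of this.

WHAT. The lead's `GenusKolyTwistTamagawa.natCard_selmerGroup_twist_eq_of_menu` (Cor. 3.4 (ii) in place-menu form) offers four rows at
a finite place — SPLIT, TAMAGAWA-ODD off `2`, BOTH GOOD off `2`, BOTH SILENT off `2` — so at a place ABOVE `2` only the split row was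
available. With files 37–40 (Mazur's norm theorem / Kramer Props. 1, 2 (a) in the engine's currency) a FIFTH finite row is served for
the SAME identification `E^{(d)}[2] ≅ E[2]`: `v` UNRAMIFIED in `K(√d)` (`ι√d ∈ K_v^{nr}`) with `W` good at `v`, or multiplicative at
`v` with `ord_v Δ_min` odd — Lemma 2.10 (v), (iii), with NO restriction on the residue characteristic:

* §96 `transport_twist_agree_inr_of_menu₅` (agreement at a finite place from the five-row menu),
  `transport_twist_agree_of_menu₅` (everywhere), and **`natCard_selmerGroup_twist_eq_of_menu₅`** — `#Sel₂(Wd) = #Sel₂(W)` when every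
  finite place is on the five-row menu and every infinite place on the two-row menu (split ∨ `H¹ = 0`), over every number field,
  UNCONDITIONALLY (no duality). The `K = ℚ` discharge of `MazurRubin2010.d2_eq_of_lemma210_rat` is the sequel file.

References: [MazurRubin2010] Lemma 2.9, Lemma 2.10 (i)–(v), proof of Prop. 3.3 (first display), Cor. 3.4 (ii) (arXiv:0904.3709 pp. 7–10);
[Kramer1981] §2 Props. 1, 2 (a), Prop. 7; [KramerTunnell1982] §6 Lemma 6.1; [MilneADT2006] I Lemma 3.3.
-/

set_option linter.dupNamespace false -- tree convention: `Summit.BirchSwinnertonDyer.BirchSwinnertonDyer.Theorems` (summit = sub-problem)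
set_option autoImplicit false

noncomputable section

open scoped Classical ContRepresentation

namespace Summit.BirchSwinnertonDyer.BirchSwinnertonDyer.Theorems.GenusKolyArch

open WeierstrassCurve Field NumberField IsDedekindDomain Function
open Literature.NumberTheory.EllipticCurves Literature.NumberTheory.GaloisRepresentations
open Literature.NumberTheory.GaloisRepresentations.IsNonarchimedeanLocalField (maxUnramified)
open Literature.NumberTheory.GaloisRepresentations.DiscreteGaloisModule (SelmerStructure)
open Literature.NumberTheory.GaloisCohomology
open Summit.BirchSwinnertonDyer.Rank1Residual.X11b.CongruentTransfer
open Summit.BirchSwinnertonDyer.BirchSwinnertonDyer.Theorems.GenusKolyTwistTamagawa (transport_twist_agree_inr_of_menu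
  transport_twist_agree_inl_of_menu)

/-! ## §96 The five-row finite menu and the `T = ∅` law -/

section Menu

variable {K : Type} [Field K] [NumberField K] (W : WeierstrassCurve K) [W.IsElliptic]

/-- **Agreement of the transported Kummer structure with `𝓚_E` at a FINITE place on the FIVE-row menu** (Mazur–Rubin Lemma 2.10 (i),
(ii), (iii), (v); rows 2–4 in the lead's `v ∤ 2` forms, row 5 = unramified-in-`K(√d)` with good / multiplicative-odd reduction at ANY
residue characteristic), for an identification `φ` carrying both the split-place agreement `hsplit` and the unramified row `hunr`.
[cite: MazurRubin2010, Lemma 2.9, Lemma 2.10 (i), (ii), (iii), (v)] -/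
theorem transport_twist_agree_inr_of_menu₅ {Wd : WeierstrassCurve K} [Wd.IsElliptic] {d : K}
    (φ : (Wd.torsionGaloisModule ((2 : ℕ) : ℤ)).toContRepresentation →ⁱL
      (W.torsionGaloisModule ((2 : ℕ) : ℤ)).toContRepresentation)
    (ψ : (W.torsionGaloisModule ((2 : ℕ) : ℤ)).toContRepresentation →ⁱL
      (Wd.torsionGaloisModule ((2 : ℕ) : ℤ)).toContRepresentation)
    (hφψ : ∀ b, φ (ψ b) = b)
    (hsplit : ∀ (E : Type) [Field E] [Algebra K E], (∃ s : E, s ^ 2 = algebraMap K E d) →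
      (Wd.kummerLocalConditionAt ((2 : ℕ) : ℤ) E).map (galoisCohomology.map (φ.restrictField E) 1) =
        W.kummerLocalConditionAt ((2 : ℕ) : ℤ) E)
    (hunr : ∀ (v : HeightOneSpectrum (𝓞 K)),
      (W.HasGoodReductionAt v ∨ (W.HasMultiplicativeReductionAt v ∧ Odd (W.ordMinimalDiscriminant v))) →
      closureEmb (K := K) (v.adicCompletion K) (geomSqrt d) ∈ maxUnramified (v.adicCompletion K) →
      (Wd.kummerLocalConditionAt ((2 : ℕ) : ℤ) (v.adicCompletion K)).map
          (galoisCohomology.map (φ.restrictField (v.adicCompletion K)) 1) =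
        W.kummerLocalConditionAt ((2 : ℕ) : ℤ) (v.adicCompletion K))
    (𝓐 : SelmerStructure (W.torsionGaloisModule ((2 : ℕ) : ℤ)))
    (h𝓐 : ∀ v, 𝓐 v = (Wd.kummerSelmerStructure ((2 : ℕ) : ℤ) v).map
      (galoisCohomology.map (φ.restrictField (Place.Completion v)) 1))
    (v : HeightOneSpectrum (𝓞 K))
    (hv : (∃ s : v.adicCompletion K, s ^ 2 = algebraMap K (v.adicCompletion K) d) ∨
      (((2 : ℕ) : 𝓞 K) ∉ v.asIdeal ∧
        ¬ 2 ∣ (W.baseChange (v.adicCompletion K)).localTamagawaNumber (v.adicCompletionIntegers K) ∧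
        ¬ 2 ∣ (Wd.baseChange (v.adicCompletion K)).localTamagawaNumber (v.adicCompletionIntegers K)) ∨
      (((2 : ℕ) : 𝓞 K) ∉ v.asIdeal ∧ W.HasGoodReductionAt v ∧ Wd.HasGoodReductionAt v) ∨
      (((2 : ℕ) : 𝓞 K) ∉ v.asIdeal ∧
        Nat.card (nsmulAddMonoidHom 2 : (W.baseChange (v.adicCompletion K)).toAffine.Point →+ _).ker = 1 ∧
        Nat.card (nsmulAddMonoidHom 2 : (Wd.baseChange (v.adicCompletion K)).toAffine.Point →+ _).ker = 1) ∨
      ((W.HasGoodReductionAt v ∨ (W.HasMultiplicativeReductionAt v ∧ Odd (W.ordMinimalDiscriminant v))) ∧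
        closureEmb (K := K) (v.adicCompletion K) (geomSqrt d) ∈ maxUnramified (v.adicCompletion K))) :
    𝓐 (Sum.inr v) = W.kummerSelmerStructure ((2 : ℕ) : ℤ) (Sum.inr v) := by
  rcases hv with h | h | h | h | ⟨hred, hα⟩
  · exact transport_twist_agree_inr_of_menu W φ ψ hφψ hsplit 𝓐 h𝓐 v (Or.inl h)
  · exact transport_twist_agree_inr_of_menu W φ ψ hφψ hsplit 𝓐 h𝓐 v (Or.inr (Or.inl h))
  · exact transport_twist_agree_inr_of_menu W φ ψ hφψ hsplit 𝓐 h𝓐 v (Or.inr (Or.inr (Or.inl h)))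
  · exact transport_twist_agree_inr_of_menu W φ ψ hφψ hsplit 𝓐 h𝓐 v (Or.inr (Or.inr (Or.inr h)))
  · rw [h𝓐, kummerSelmerStructure_apply, kummerSelmerStructure_apply]
    exact hunr v hred hα

/-- **Mazur–Rubin Cor. 3.4 (ii) / Prop. 3.3 at `T = ∅` in FIVE-row place-menu form, over every number field, UNCONDITIONALLY.** `W`
elliptic over a number field `K`, `d ≠ 0`, `Wd` ANY elliptic model of `W^{(d)}`. IF every finite place is SPLIT (`d ∈ K_v²`), or
lies over an odd prime with `2 ∤ c_v(W)`, `2 ∤ c_v(Wd)`, or with both curves good, or with both curves silent, OR is UNRAMIFIED in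
`K(√d)` (`ι√d ∈ K_v^{nr}`, any residue characteristic — `v ∣ 2` with `2` inert included) with `W` good or multiplicative with
`ord_v Δ_min` odd; and every infinite place is split or has `H¹(K_w, W) = 0 = H¹(K_w, Wd)`; THEN `#Sel₂(Wd) = #Sel₂(W)`. Proof: ONE
identification `E^{(d)}[2] ≅ E[2]` carrying Lemma 2.10 (i), (iii), (v) (`exists_intertwining_hsplit_and_unramified`, files 37–40)
transports `𝓚_{Wd}` to a Selmer structure which IS `𝓚_W` place by place; transport preserves the Selmer count. No duality.
[cite: MazurRubin2010, Lemma 2.10 (i)–(v), proof of Prop. 3.3 (first display), Cor. 3.4 (ii) (arXiv:0904.3709 pp. 7–10)]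
[cite: Kramer1981, §2 Props. 1 and 2 (a), Prop. 7] [cite: KramerTunnell1982, §6 Lemma 6.1, type I₀] -/
theorem natCard_selmerGroup_twist_eq_of_menu₅ {d : K} (hd : d ≠ 0) {Wd : WeierstrassCurve K} [Wd.IsElliptic]
    {C : VariableChange K} (hWd : C • W.quadraticTwist d = Wd)
    (hfin : ∀ v : HeightOneSpectrum (𝓞 K),
      (∃ s : v.adicCompletion K, s ^ 2 = algebraMap K (v.adicCompletion K) d) ∨
      (((2 : ℕ) : 𝓞 K) ∉ v.asIdeal ∧
        ¬ 2 ∣ (W.baseChange (v.adicCompletion K)).localTamagawaNumber (v.adicCompletionIntegers K) ∧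
        ¬ 2 ∣ (Wd.baseChange (v.adicCompletion K)).localTamagawaNumber (v.adicCompletionIntegers K)) ∨
      (((2 : ℕ) : 𝓞 K) ∉ v.asIdeal ∧ W.HasGoodReductionAt v ∧ Wd.HasGoodReductionAt v) ∨
      (((2 : ℕ) : 𝓞 K) ∉ v.asIdeal ∧
        Nat.card (nsmulAddMonoidHom 2 : (W.baseChange (v.adicCompletion K)).toAffine.Point →+ _).ker = 1 ∧
        Nat.card (nsmulAddMonoidHom 2 : (Wd.baseChange (v.adicCompletion K)).toAffine.Point →+ _).ker = 1) ∨
      ((W.HasGoodReductionAt v ∨ (W.HasMultiplicativeReductionAt v ∧ Odd (W.ordMinimalDiscriminant v))) ∧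
        closureEmb (K := K) (v.adicCompletion K) (geomSqrt d) ∈ maxUnramified (v.adicCompletion K)))
    (hinf : ∀ w : InfinitePlace K,
      (∃ s : w.Completion, s ^ 2 = algebraMap K w.Completion d) ∨
      ((∀ x : galoisCohomology (W.localGaloisModule w.Completion) 1, x = 0) ∧
        (∀ x : galoisCohomology (Wd.localGaloisModule w.Completion) 1, x = 0))) :
    Nat.card (Wd.selmerGroup ((2 : ℕ) : ℤ)) = Nat.card (W.selmerGroup ((2 : ℕ) : ℤ)) := by
  haveI : Fact (Nat.Prime 2) := ⟨Nat.prime_two⟩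
  obtain ⟨φ, ψ, hψφ, hφψ, hsplit, hunr⟩ := exists_intertwining_hsplit_and_unramified W Wd hd hWd
  let 𝓐 : SelmerStructure (W.torsionGaloisModule ((2 : ℕ) : ℤ)) := fun v ↦
    (Wd.kummerSelmerStructure ((2 : ℕ) : ℤ) v).map (galoisCohomology.map (φ.restrictField (Place.Completion v)) 1)
  have h𝓐 : ∀ v, 𝓐 v = (Wd.kummerSelmerStructure ((2 : ℕ) : ℤ) v).map
      (galoisCohomology.map (φ.restrictField (Place.Completion v)) 1) := fun _ ↦ rfl
  have hagree : ∀ v : Place K, 𝓐 v = W.kummerSelmerStructure ((2 : ℕ) : ℤ) v := by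
    rintro (w | v)
    · exact transport_twist_agree_inl_of_menu W φ ψ hφψ hsplit 𝓐 h𝓐 w (hinf w)
    · exact transport_twist_agree_inr_of_menu₅ W φ ψ hφψ hsplit hunr 𝓐 h𝓐 v (hfin v)
  have hA : 𝓐 = W.kummerSelmerStructure ((2 : ℕ) : ℤ) := funext hagree
  have h := natCard_selmerGroup_transport_kummer W Wd 2 φ ψ hψφ hφψ 𝓐 h𝓐
  rw [hA, ← selmerGroup_eq_selmerGroup_kummerSelmerStructure] at h
  exact h.symm

end Menu

end Summit.BirchSwinnertonDyer.BirchSwinnertonDyer.Theorems.GenusKolyArch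

end
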